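/-
Copyright (c) 2026. All rights reserved.
Released under Apache 2.0 license as described in the file LICENSE.
Authors: abc-iut cell, campaign-S prover seat abc-iut-S5 (wave 2).
-/
import Mathlib.RingTheory.Trace.Basic
import Mathlib.LinearAlgebra.PiTensorProduct.Finite
import Literature.RingTheory.Trace.PiTensorProduct
import Literature.IUT.LogVolume.PacketBases
import Literature.IUT.LogVolume.IntegralTrace
import HarnessLib

/-!
# `p^{d_{I*}} · (R_I)^∼ ⊆ R_I`: the different bound for the tensor packet ring ([IUTchIV] Prop. 1.1)

Mochizuki, *Inter-universal Teichmüller theory IV*, RIMS manuscript (Apr. 2020), §1, Proposition 1.1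
"(Multiple Tensor Products and Differents)", kurims p. 9: for finite extensions `k_i/ℚ_p` (`i ∈ I`),
`R_I = ⊗_{ℤ_p} R_i`, `* ∈ I`, and generators `δ_i` of the differents of the `R_i` (`i ≠ *`),
`p^{d_{I*}}·(R_I)^∼ ⊆ R_I ⊆ (R_I)^∼`.  This file DISCHARGES the typed statement
`Literature.IUT.LogVolume.Prop11` of `TensorPacketRing.lean` (`prop11_holds`).

Proof (the text: "regard `R_I` as an `R_*`-algebra … the desired inclusion follows immediately from the
definition of the different ideal"; made explicit): let `b^{(i)}` be `ℤ_p`-bases of the `R_i` and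
`c^{(i)}` the trace-dual `ℚ_p`-bases of the `k_i`, so that `δ_i c^{(i)}_j ∈ R_i` (the dual of `R_i` is
`𝔇_i⁻¹`, Mathlib `coeIdeal_differentIdeal`).  Expand `x ∈ (R_I)^∼` in the tensor basis `C'` built from
`b^{(*)}` at `*` and `c^{(i)}` at `i ≠ *`.  For a multi-index `J`, the element
`y_J = 1 ⊗ (⊗_{i≠*} b^{(i)}_{J_i}) ∈ R_I` gives `x·y_J ∈ (R_I)^∼`, so `Tr_{V/k_*}(x·y_J) ∈ R_*`
(`norm_relTrace_le_one`); by `Tr_{V/k_*}(⊗ z_i) = z_*·∏_{i≠*}Tr(z_i)` and duality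
this trace is `∑_j x_{J[*↦j]} b^{(*)}_j`, whose `b^{(*)}`-coordinates are the `x_{J[*↦j]}`; hence every
coordinate `x_J ∈ ℤ_p`, and `(⊗δ_i)·x = ∑_J x_J ⊗_i(δ_i c'^{(i)}_{J_i})` is a `ℤ_p`-combination of
integer pure tensors.  The cardinality hypothesis `|I| ≥ 2` of the text is not needed.

Ingredients proved here (the single-field part — integral and trace-dual bases, `δ·c_j ∈ R` — is
`IntegralBases.lean`; the trace integrality over a DVR is `IntegralTrace.lean`):
* `trace_purePacket` — `Tr_{V/ℚ_p}(⊗ x_i) = ∏_i Tr_{k_i/ℚ_p}(x_i)` (the tree's `trace_piTensorProduct_tprod`);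
* `relTrace_purePacket` — for ANY `k_*`-algebra structure on `V` with structure map `ι_*` (a hypothesis
  `[Algebra (k star) V]` + `algebraMap = ι_*`, instantiated by `(iota p k star).toRingHom.toAlgebra`; no
  instance is declared): `Tr_{V/k_*}(⊗ x_i) = x_* · ∏_{i ≠ *} Tr_{k_i/ℚ_p}(x_i)`, from the previous formula
  by transitivity `Tr_{k_*/ℚ_p} ∘ Tr_{V/k_*} = Tr_{V/ℚ_p}` and non-degeneracy of the trace form of `k_*/ℚ_p`;
* `norm_relTrace_le_one` — `Tr_{V/k_*}((R_I)^∼) ⊆ R_*` (`(R_I)^∼` is integral over `ℤ_p`, hence over `R_*`);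
* `purePacket_mul_mem_integerPacket` — `(⊗_{i≠*} δ_i ⊗ 1)·x ∈ R_I` for `x ∈ (R_I)^∼`;
* `purePacket_mul_mem_integerPacket'` — the weaker all-`δ` form `(⊗_{i∈I} δ_i)·(R_I)^∼ ⊆ R_I` used by
  [IUTchIV] Prop. 1.2 (ii) (p. 11: "`p^{d_I+a_I}·(R_I)^∼ ⊆ ⊗ p^{a_i}·R_i`");
* `prop11_holds : Prop11 p k`.
-/

noncomputable section

open Metric Set Function Module
open scoped Pointwise TensorProduct NormedField nonZeroDivisors

namespace Literature.IUT.LogVolume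


section RelativeTrace

variable (p : ℕ) [Fact p.Prime]
variable {I : Type} [Fintype I]
variable (k : I → Type) [∀ i, NontriviallyNormedField (k i)] [∀ i, NormedAlgebra ℚ_[p] (k i)]
variable [∀ i, IsUltrametricDist (k i)] [∀ i, ProperSpace (k i)]

/-! ## Finiteness of `V` over `ℚ_p` and the absolute trace of a pure tensor -/

/-- `V = ⊗_{ℚ_p} k_i` is finite-dimensional over `ℚ_p`. [claim: Mochizuki2012, status: disputed] -/
theorem moduleFinite_packet : Module.Finite ℚ_[p] (PacketAlgebra p k) := by
  haveI := fun i => finiteDimensional p (k i)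
  infer_instance

/-- **`Tr_{V/ℚ_p}(⊗ x_i) = ∏_i Tr_{k_i/ℚ_p}(x_i)`** (the tree's general `trace_piTensorProduct_tprod`,
abc-iut-S6, specialised to the packet algebra). [claim: Mochizuki2012, status: disputed] -/
theorem trace_purePacket (x : Π i, k i) :
    Algebra.trace ℚ_[p] (PacketAlgebra p k) (purePacket p k x) =
      ∏ i, Algebra.trace ℚ_[p] (k i) (x i) := by
  haveI := fun i => finiteDimensional p (k i)
  exact Literature.RingTheory.Trace.trace_piTensorProduct_tprod x

/-! ## The `k_*`-algebra structure through `ι_*` -/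

section RelTrace

variable [DecidableEq I] (star : I) [Algebra (k star) (PacketAlgebra p k)]
  (hV : ∀ a : k star, algebraMap (k star) (PacketAlgebra p k) a = iota p k star a)
include hV

omit [Fintype I] [∀ i, IsUltrametricDist (k i)] [∀ i, ProperSpace (k i)] in
/-- The tower `ℚ_p → k_* → V` (for the structure through `ι_*`). [claim: Mochizuki2012, status: disputed] -/
theorem isScalarTower_star : IsScalarTower ℚ_[p] (k star) (PacketAlgebra p k) :=
  IsScalarTower.of_algebraMap_eq fun c => by rw [hV, AlgHom.commutes]

omit [Fintype I] [∀ i, IsUltrametricDist (k i)] [∀ i, ProperSpace (k i)] in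
/-- `a · (⊗ x_i) = ⊗ x'_i` with `x'_* = a x_*` (the `k_*`-action through `ι_*`).
[claim: Mochizuki2012, status: disputed] -/
theorem star_smul_purePacket (a : k star) (x : Π i, k i) :
    a • purePacket p k x = purePacket p k (update x star (a * x star)) := by
  rw [Algebra.smul_def, hV, iota_mul_purePacket]

/-- `V` is a finite `k_*`-module. [claim: Mochizuki2012, status: disputed] -/
theorem moduleFinite_star : Module.Finite (k star) (PacketAlgebra p k) := by
  haveI := isScalarTower_star p k star hV
  haveI := moduleFinite_packet p k
  exact Module.Finite.of_restrictScalars_finite ℚ_[p] (k star) (PacketAlgebra p k)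

/-- **The relative trace of a pure tensor**: `Tr_{V/k_*}(⊗ x_i) = x_* · ∏_{i ≠ *} Tr_{k_i/ℚ_p}(x_i)`
(by `Tr_{k_*/ℚ_p} ∘ Tr_{V/k_*} = Tr_{V/ℚ_p}`, `trace_purePacket`, and non-degeneracy of the trace form
of the separable extension `k_*/ℚ_p`). [claim: Mochizuki2012, status: disputed] -/
theorem relTrace_purePacket (x : Π i, k i) :
    Algebra.trace (k star) (PacketAlgebra p k) (purePacket p k x) =
      x star * algebraMap ℚ_[p] (k star) (∏ i ∈ Finset.univ.erase star, Algebra.trace ℚ_[p] (k i) (x i)) := by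
  haveI := isScalarTower_star p k star hV
  haveI := fun i => finiteDimensional p (k i)
  haveI := moduleFinite_packet p k
  haveI := moduleFinite_star p k star hV
  set c : ℚ_[p] := ∏ i ∈ Finset.univ.erase star, Algebra.trace ℚ_[p] (k i) (x i) with hc
  set T := Algebra.trace (k star) (PacketAlgebra p k) (purePacket p k x) with hT
  -- test against every `a ∈ k_*` with the trace form of `k_*/ℚ_p`
  have key : ∀ a : k star, Algebra.trace ℚ_[p] (k star) (T * a) =
      Algebra.trace ℚ_[p] (k star) (x star * algebraMap ℚ_[p] (k star) c * a) := by
    intro a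
    have h1 : T * a = Algebra.trace (k star) (PacketAlgebra p k) (a • purePacket p k x) := by
      rw [LinearMap.map_smul, smul_eq_mul, mul_comm]
    rw [h1, Algebra.trace_trace, star_smul_purePacket p k star hV, trace_purePacket,
      ← Finset.prod_erase_mul _ _ (Finset.mem_univ star), update_self]
    have h2 : ∏ i ∈ Finset.univ.erase star, Algebra.trace ℚ_[p] (k i) (update x star (a * x star) i) = c := by
      refine Finset.prod_congr rfl fun i hi => ?_
      rw [update_of_ne (Finset.ne_of_mem_erase hi)]
    rw [h2, show x star * algebraMap ℚ_[p] (k star) c * a = c • (a * x star) by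
      rw [Algebra.smul_def]; ring, LinearMap.map_smul, smul_eq_mul]
  -- non-degeneracy of the trace form
  have hnd := traceForm_nondegenerate ℚ_[p] (k star)
  have h0 : T - x star * algebraMap ℚ_[p] (k star) c = 0 := by
    refine hnd.1 _ fun a => ?_
    rw [Algebra.traceForm_apply, sub_mul, map_sub, key, sub_self]
  exact sub_eq_zero.mp h0

/-- **`Tr_{V/k_*}` of an element of `(R_I)^∼` lies in `R_* = 𝒪_{k_*}`** (integral over `ℤ_p`, hence
over the discrete valuation ring `R_*`; `trace_mem_range_of_isIntegral`). This is the step "from the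
definition of the different ideal" of the proof of [IUTchIV] Prop. 1.1 (p. 9).
[claim: Mochizuki2012, status: disputed] -/
theorem norm_relTrace_le_one {z : PacketAlgebra p k} (hz : z ∈ normalizedPacket p k) :
    ‖Algebra.trace (k star) (PacketAlgebra p k) z‖ ≤ 1 := by
  haveI := isScalarTower_star p k star hV
  haveI := moduleFinite_star p k star hV
  letI : Algebra (Valued.integer (k star)) (PacketAlgebra p k) :=
    ((algebraMap (k star) (PacketAlgebra p k)).comp
      (algebraMap (Valued.integer (k star)) (k star))).toAlgebra
  haveI : IsScalarTower (Valued.integer (k star)) (k star) (PacketAlgebra p k) :=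
    IsScalarTower.of_algebraMap_eq fun _ => rfl
  haveI : IsScalarTower ℤ_[p] (Valued.integer (k star)) (PacketAlgebra p k) :=
    IsScalarTower.of_algebraMap_eq fun r => by
      rw [IsScalarTower.algebraMap_apply ℤ_[p] ℚ_[p] (PacketAlgebra p k),
        RingHom.algebraMap_toAlgebra, RingHom.comp_apply,
        ← IsScalarTower.algebraMap_apply ℤ_[p] (Valued.integer (k star)) (k star),
        algebraMap_padicInt_apply, hV, AlgHom.commutes, PadicInt.algebraMap_apply]
  have hz' : IsIntegral (Valued.integer (k star)) z := (isIntegral_of_mem_normalizedPacket p k hz).tower_top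
  obtain ⟨r, hr⟩ := trace_mem_range_of_isIntegral (K := k star) hz'
  rw [← hr]
  exact Valued.integer.norm_le_one r

end RelTrace

end RelativeTrace

/-! ## The different bound -/

section Main

variable (p : ℕ) [Fact p.Prime]
variable {I : Type} [Fintype I] [DecidableEq I]
variable (k : I → Type) [∀ i, NontriviallyNormedField (k i)] [∀ i, NormedAlgebra ℚ_[p] (k i)]
variable [∀ i, IsUltrametricDist (k i)] [∀ i, ProperSpace (k i)]

/-- **`p^{d_{I*}}·(R_I)^∼ ⊆ R_I`** ([IUTchIV] Prop. 1.1, first inclusion, p. 9): for `* ∈ I`, generators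
`δ_i` of the differents of the `R_i` for `i ≠ *` and `δ_* = 1`, and every `x ∈ (R_I)^∼`,
`(⊗_i δ_i)·x ∈ R_I`.  (No hypothesis on `|I|`.) [claim: Mochizuki2012, status: disputed] -/
theorem purePacket_mul_mem_integerPacket (star : I) (δ : Π i, Valued.integer (k i))
    (hδ : ∀ i, i ≠ star → different p (k i) = Ideal.span {δ i}) (hstar : δ star = 1)
    {x : PacketAlgebra p k} (hx : x ∈ normalizedPacket p k) :
    purePacket p k (fun i => (δ i : k i)) * x ∈ integerPacket p k := by
  haveI : Nonempty I := ⟨star⟩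
  -- integral bases `bZ i` / `bQ i` of `R_i` / `k_i`, trace-dual bases `cQ i`
  have hbases := fun i => exists_integralBasis (p := p) (k i)
  choose n bZ bQ hb using hbases
  have hduals := fun i => exists_traceDual_basis (p := p) (bQ i)
  choose cQ hc using hduals
  -- the mixed family: `b` at `*`, `c` elsewhere, and its tensor basis
  let c' : Π i, Basis (Fin (n i)) ℚ_[p] (k i) := update cQ star (bQ star)
  have c'_star : c' star = bQ star := update_self ..
  have c'_ne : ∀ i, i ≠ star → c' i = cQ i := fun i hi => update_of_ne hi ..
  let C := Basis.piTensorProduct c'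
  -- the `k_*`-algebra structure through `ι_*`
  letI : Algebra (k star) (PacketAlgebra p k) := (iota p k star).toRingHom.toAlgebra
  have hV : ∀ a : k star, algebraMap (k star) (PacketAlgebra p k) a = iota p k star a := fun _ => rfl
  haveI := isScalarTower_star p k star hV
  -- Step 1: every `C`-coordinate of `x` lies in `ℤ_p`
  have hcoord : ∀ J : Π i, Fin (n i), ‖C.repr x J‖ ≤ 1 := by
    intro J
    -- the test element `y_J = 1 ⊗ (⊗_{i≠*} b^{(i)}_{J i}) ∈ R_I`
    let yv : Π i, k i := update (fun i => (bQ i (J i) : k i)) star 1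
    have hy : purePacket p k yv ∈ integerPacket p k := by
      refine purePacket_mem_integerPacket p k fun i => ?_
      by_cases hi : i = star
      · subst hi; simp [yv]
      · simp only [yv, update_of_ne hi]
        exact norm_basis_le_one (bZ i) (bQ i) (hb i) (J i)
    -- its relative trace against `x` is an integer of `k_*`
    set T := Algebra.trace (k star) (PacketAlgebra p k) (x * purePacket p k yv) with hT
    have hTint : ‖T‖ ≤ 1 :=
      norm_relTrace_le_one p k star hV (mul_mem_normalizedPacket p k hx
        (integerPacket_le_normalizedPacket p k hy))
    -- compute the trace of `C J' · y_J`
    have htr : ∀ J' : Π i, Fin (n i),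
        Algebra.trace (k star) (PacketAlgebra p k) (C J' * purePacket p k yv) =
          if (∀ i ∈ Finset.univ.erase star, J i = J' i) then bQ star (J' star) else 0 := by
      intro J'
      rw [Basis.piTensorProduct_apply, show (⨂ₜ[ℚ_[p]] i, (c' i) (J' i)) =
        purePacket p k (fun i => c' i (J' i)) from rfl, purePacket_mul,
        relTrace_purePacket p k star hV]
      have hst : ((fun i => (c' i (J' i) : k i)) * yv) star = bQ star (J' star) := by
        simp only [Pi.mul_apply, yv, update_self, mul_one, c'_star]
      have hfac : ∀ i ∈ Finset.univ.erase star,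
          Algebra.trace ℚ_[p] (k i) (((fun i => (c' i (J' i) : k i)) * yv) i) =
            if J i = J' i then 1 else 0 := by
        intro i hi
        have hi' : i ≠ star := Finset.ne_of_mem_erase hi
        simp only [Pi.mul_apply, yv, update_of_ne hi', c'_ne i hi', hc]
      have hprod : ∏ i ∈ Finset.univ.erase star,
          Algebra.trace ℚ_[p] (k i) (((fun i => (c' i (J' i) : k i)) * yv) i) =
            if (∀ i ∈ Finset.univ.erase star, J i = J' i) then 1 else 0 := by
        by_cases hall : ∀ i ∈ Finset.univ.erase star, J i = J' i
        · rw [if_pos hall]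
          exact Finset.prod_eq_one fun i hi => by rw [hfac i hi, if_pos (hall i hi)]
        · rw [if_neg hall]
          push Not at hall
          obtain ⟨i, hi, hne⟩ := hall
          exact Finset.prod_eq_zero hi (by rw [hfac i hi, if_neg hne])
      rw [hst, hprod]
      split_ifs <;> simp
    -- hence `T = ∑_j x_{J[*↦j]} • b^{(*)}_j`
    have hTsum : T = ∑ j : Fin (n star), C.repr x (update J star j) • bQ star j := by
      have hx' : x * purePacket p k yv = ∑ J', (C.repr x J') • (C J' * purePacket p k yv) := by
        conv_lhs => rw [← C.sum_repr x]
        rw [Finset.sum_mul]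
        simp_rw [smul_mul_assoc]
      have hterm : ∀ J', Algebra.trace (k star) (PacketAlgebra p k)
          ((C.repr x J') • (C J' * purePacket p k yv)) =
            C.repr x J' • (if (∀ i ∈ Finset.univ.erase star, J i = J' i)
              then bQ star (J' star) else 0) := by
        intro J'
        rw [← IsScalarTower.algebraMap_smul (k star) (C.repr x J'), LinearMap.map_smul,
          htr, IsScalarTower.algebraMap_smul]
      rw [hT, hx', map_sum]
      simp_rw [hterm, smul_ite, smul_zero]
      rw [← Finset.sum_filter]
      have hmem : ∀ {i}, i ∈ Finset.univ.erase star ↔ i ≠ star := fun {i} => by simp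
      have hupd : ∀ J' : Π i, Fin (n i), (∀ i ∈ Finset.univ.erase star, J i = J' i) →
          update J star (J' star) = J' := by
        intro J' hJ'
        funext i
        by_cases hi : i = star
        · subst hi; simp
        · rw [update_of_ne hi, hJ' i (hmem.mpr hi)]
      refine Finset.sum_nbij' (fun J' => J' star) (fun j => update J star j) ?_ ?_ ?_ ?_ ?_
      · intro J' _; exact Finset.mem_univ _
      · intro j _
        rw [Finset.mem_filter]
        exact ⟨Finset.mem_univ _, fun i hi => (update_of_ne (hmem.mp hi) ..).symm⟩
      · intro J' hJ'
        rw [Finset.mem_filter] at hJ'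
        exact hupd J' hJ'.2
      · intro j _; simp
      · intro J' hJ'
        rw [Finset.mem_filter] at hJ'
        rw [hupd J' hJ'.2]
    -- read off the `b^{(*)}`-coordinate at `J *`
    have hrepr : (bQ star).repr T (J star) = C.repr x J := by
      rw [hTsum, (bQ star).repr_sum_self, update_eq_self]
    rw [← hrepr]
    exact norm_repr_le_one (bZ star) (bQ star) (hb star) hTint (J star)
  -- Step 2: `(⊗δ)·x = ∑_J x_J • ⊗_i (δ_i c'^{(i)}_{J_i})` is a `ℤ_p`-combination of integer pure tensors
  rw [← C.sum_repr x, Finset.mul_sum]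
  refine sum_mem fun J _ => ?_
  rw [mul_smul_comm]
  refine smul_mem_integerPacket p k (hcoord J) ?_
  rw [Basis.piTensorProduct_apply, show (⨂ₜ[ℚ_[p]] i, (c' i) (J i)) =
    purePacket p k (fun i => c' i (J i)) from rfl, purePacket_mul]
  refine purePacket_mem_integerPacket p k fun i => ?_
  rw [Pi.mul_apply]
  by_cases hi : i = star
  · subst hi
    rw [hstar, c'_star, OneMemClass.coe_one, one_mul]
    exact norm_basis_le_one (bZ i) (bQ i) (hb i) (J i)
  · rw [c'_ne i hi]
    exact norm_mul_le_one_of_traceDual (bZ i) (bQ i) (hb i) (cQ i) (hc i) (hδ i hi) (J i)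

/-- **`p^{d_I}·(R_I)^∼ ⊆ R_I`** — the all-`δ` form (generators `δ_i` of ALL the differents), as used in
the proof of [IUTchIV] Prop. 1.2 (ii), p. 11 ("it follows from the first displayed inclusion [of
`R_I`-modules!] of Proposition 1.1 that `p^{d_I+a_I}·(R_I)^∼ ⊆ ⊗ p^{a_i}·R_i`").
[claim: Mochizuki2012, status: disputed] -/
theorem purePacket_mul_mem_integerPacket' [Nonempty I] (δ : Π i, Valued.integer (k i))
    (hδ : ∀ i, different p (k i) = Ideal.span {δ i})
    {x : PacketAlgebra p k} (hx : x ∈ normalizedPacket p k) :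
    purePacket p k (fun i => (δ i : k i)) * x ∈ integerPacket p k := by
  obtain ⟨star⟩ := ‹Nonempty I›
  let δ' : Π i, Valued.integer (k i) := update δ star 1
  have h' := purePacket_mul_mem_integerPacket p k star δ' (fun i hi => by
    rw [show δ' i = δ i from update_of_ne hi ..]; exact hδ i) (update_self ..) hx
  have hsplit : purePacket p k (fun i => (δ i : k i)) =
      iota p k star (δ star : k star) * purePacket p k (fun i => (δ' i : k i)) := by
    rw [iota_mul_purePacket]
    congr 1
    funext i
    by_cases hi : i = star
    · subst hi; simp [δ']
    · simp [δ', update_of_ne hi]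
  rw [hsplit, mul_assoc]
  exact mul_mem (iota_mem_integerPacket p k star (Valued.integer.norm_le_one _)) h'

/-- **[IUTchIV] Proposition 1.1 holds** (`TensorPacketRing.Prop11` discharged): for `|I| ≥ 2`, `* ∈ I`,
generators `δ_i` (`i ≠ *`) of the differents and `δ_* = 1`:
`(⊗δ_i)·(R_I)^∼ ⊆ R_I` and `R_I ⊆ (R_I)^∼`. [claim: Mochizuki2012, status: disputed] -/
theorem prop11_holds : Prop11 p k := by
  intro _ star δ hδ hstar
  exact ⟨fun x hx => purePacket_mul_mem_integerPacket p k star δ hδ hstar hx,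
    integerPacket_le_normalizedPacket p k⟩

end Main

end Literature.IUT.LogVolume

end
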